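import Summits.BirchSwinnertonDyer.Rank1Residual.O5.ThreeTorsionNormalFormKummer
import HarnessLib

/-!
# Integral points of the `3`-adic flex form `Y² + 3B·XY + D·Y = X³` with `D ≡ B³ (mod 27)`: every `Y` is a cube
# (cell `b2b-bsdres`, team n1011, ROW T-FLEX-PTW FILE P1a — class-free TOOL; seat `b2b-bsdres-n1011-p18`
#  GEN 16 under the idle rule; continued by `O5/FlexTrivialCubeClassThree.lean` (P1b) and the END file
#  `O5/TrivialKummerImagePotTwistThreeProofs.lean` (P2), T29.4 (b2)/(b3))

HONEST FRAMING (cell `b2b-bsdres`, run/shared/lean/b2b/bsd-rank1-residual/, verbatim in every file): the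
goal of the cell is to DELETE the COMBINATION-SHAPED residual classes of the Birch–Swinnerton-Dyer formula
for ALL analytic-rank `≤ 1` elliptic curves over `ℚ` — "full BSD formula for every rank `≤ 1` curve in
class `C`" assembled STRICTLY from published theorems — so that the rank-`≤ 1` remainder becomes exactly
the CONSTRUCTION-SHAPED classes, which are TYPED (missing-input `Prop`s), NOT attempted. This is not
"finishing BSD". Lane CLASS-CLOSURE / O5 (O5 OPEN): research route; census output (P-K18 / P-K19) is
EVIDENCE, never a Literature fact; nothing is booked; no mark of `RESIDUAL-MAP.md` moves. This file:
THEOREMS ONLY (no definition, no named fact, no `@[conjecture]` node, no `sorry`; net named-fact debt `0`).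
It proves NOTHING about any elliptic curve, Kodaira symbol, conductor or Selmer group: pure `3`-adic
algebra about the one cubic equation `Y² + 3B·XY + D·Y = X³` over `ℤ₃`.

## What is proved

* `exists_pow_three_eq_of_integral`: for `B, D ∈ ℤ₃` with `D` a unit and `27 ∣ B³ − D`, EVERY solution
  `(X, Y) ∈ ℤ₃²` of `Y² + 3B·XY + D·Y = X³` has `Y ∈ ℚ₃³` (a cube).  The reduction mod `3` is
  `ȳ² + d̄ȳ = x̄³`, whose affine points are `(0,0)`, `(0,−d̄)` and the cusp `(−1, d̄)` (`decide`); over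
  `(0,0)`: `27 ∣ Y` and `U := Y + 3BX + D ≡ D ≡ ±1 (mod 9)` is a cube (`±1 + 9ℤ₃ ⊆ ℚ₃³`, from x11b3-p7's
  `exists_pow_three_eq_of_norm_sub_one_le`, p308301), `Y = (X/c)³`; over `(0,−d̄)`: `27 ∣ U`, so
  `Y ≡ −D (mod 9)`; over the cusp, with `X = −1 + 3ξ`, `Y = D + 3η`, `D = B³ − 27κ`, `B² = 1 + 3μ`, the
  equation is the polynomial identity `9(η² + 3R) = S·(B² − 1 − 3μ)` (explicit `R, S`;
  `linear_combination`), so `3 ∣ η` and `Y ≡ D (mod 9)`.  NO group law, NO Néron model / component group,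
  NO Tate run, NO isogeny invariant.
In the O5 lane\'s reading (o5-r1 GEN 13, T30 §1, Case N cells `(b̄, ā₉) = (1,1)`, `w ≥ 3` = `I₀*`
potentially ordinary and `Iₙ*`): the `φ̂`-Kummer image of the integral points is trivial.  The residue
plumbing mirrors n1011-p18 GEN 15\'s `FlexNormalForm.KummerResidue` (integer parameters; banked, not yet in
the tree) for `3`-adic parameters and is kept `private` here.

References: T. and V. Dokchitser, *Local invariants of isogenous elliptic curves*, Trans. AMS 367 (2015),
Prop. 16–18 (arXiv:1208.5519 p. 8); E. F. Schaefer, J. Number Theory 56 (1996), Lemma 3.8; H. Cohen,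
F. Pazuki, Acta Arith. 140 (2009), Prop. 2.2 (`ℚ₃ˣ/ℚ₃ˣ³`); o5-r1 GEN 12 `T29-RATIONAL-TORSION-COST-LAW.md`
(law T29.4 (b2)/(b3), census P-K18 kit j141165) and GEN 13 `T30-FLAT-KUMMER-NORMAL-FORM.md` §1.
-/

noncomputable section

open Padic

namespace Summit.BirchSwinnertonDyer.Rank1Residual.O5.FlexTangent

/-! ## §1 Residue plumbing on `ℤ₃` (private) -/

section Residue

/-- `toZMod X = 0 ↔ 3 ∣ X` in `ℤ₃`. [folklore] -/
private theorem toZMod_eq_zero_iff_dvd (X : ℤ_[3]) : PadicInt.toZMod X = 0 ↔ (3 : ℤ_[3]) ∣ X := by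
  rw [← RingHom.mem_ker, PadicInt.ker_toZMod, PadicInt.maximalIdeal_eq_span_p, Ideal.mem_span_singleton]
  norm_num

/-- Residue lift modulo `3`: if `toZMod X = 0` then `X = 3ξ`. [folklore] -/
private theorem exists_eq_three_mul {X : ℤ_[3]} (h : PadicInt.toZMod X = 0) : ∃ ξ : ℤ_[3], X = 3 * ξ :=
  (toZMod_eq_zero_iff_dvd X).1 h

/-- `toZModPow 2 X = 0 ↔ 9 ∣ X` in `ℤ₃`. [folklore] -/
private theorem toZModPow_two_eq_zero_iff_dvd (X : ℤ_[3]) :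
    PadicInt.toZModPow 2 X = 0 ↔ (9 : ℤ_[3]) ∣ X := by
  rw [← RingHom.mem_ker, PadicInt.ker_toZModPow, Ideal.mem_span_singleton]
  norm_num

/-- A `3`-adic integer with non-zero residue is a unit: `toZMod U ≠ 0 → ‖U‖ = 1`. [folklore] -/
private theorem norm_eq_one_of_toZMod_ne_zero {U : ℤ_[3]} (h : PadicInt.toZMod U ≠ 0) : ‖U‖ = 1 := by
  refine le_antisymm (PadicInt.norm_le_one _) (not_lt.1 fun hlt => h ?_)
  rw [toZMod_eq_zero_iff_dvd]
  exact_mod_cast (PadicInt.norm_lt_one_iff_dvd U).1 hlt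

/-- A unit of `ℤ₃` has non-zero residue. [folklore] -/
private theorem toZMod_ne_zero_of_isUnit {U : ℤ_[3]} (h : IsUnit U) : PadicInt.toZMod U ≠ 0 := by
  intro h0
  have h3 := (toZMod_eq_zero_iff_dvd U).1 h0
  have hlt : ‖U‖ < 1 := (PadicInt.norm_lt_one_iff_dvd U).2 (by exact_mod_cast h3)
  exact hlt.ne (PadicInt.isUnit_iff.1 h)

/-- The residues modulo `9` whose square is `1` are `±1`. [folklore] -/
private theorem zmod9_sq_eq_one : ∀ t : ZMod 9, t ^ 2 = 1 → t = 1 ∨ t = -1 := by decide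

/-- **Cubes by residue: `±1 + 9ℤ₃ ⊆ ℚ₃³`.** A `3`-adic integer whose residue modulo `9` has square `1`
is a cube in `ℚ₃` (p308301's `exists_pow_three_eq_of_norm_sub_one_le` applied to `±u`). [folklore] -/
private theorem exists_pow_three_eq_of_sq_eq_one {u : ℤ_[3]} (h : (PadicInt.toZModPow 2 u) ^ 2 = 1) :
    ∃ w : ℚ_[3], (u : ℚ_[3]) = w ^ 3 := by
  obtain ⟨ε, hε, hu⟩ : ∃ ε : ℤ_[3], (ε = 1 ∨ ε = -1) ∧ PadicInt.toZModPow 2 (ε * u) = 1 := by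
    rcases zmod9_sq_eq_one _ h with h1 | h1
    · exact ⟨1, Or.inl rfl, by rw [one_mul, h1]⟩
    · exact ⟨-1, Or.inr rfl, by rw [map_mul, map_neg, map_one, h1]; ring⟩
  have h0 : PadicInt.toZModPow 2 (ε * u - 1) = 0 := by rw [map_sub, map_one, hu, sub_self]
  obtain ⟨ξ, hξ⟩ := (toZModPow_two_eq_zero_iff_dvd _).1 h0
  have h9 : ‖((ε * u : ℤ_[3]) : ℚ_[3]) - 1‖ ≤ (3 : ℝ) ^ (-2 : ℤ) := by
    have e : ((ε * u : ℤ_[3]) : ℚ_[3]) - 1 = ((9 * ξ : ℤ_[3]) : ℚ_[3]) := by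
      rw [← hξ]; push_cast; ring
    have hmem : (9 * ξ : ℤ_[3]) ∈ Ideal.span {(3 : ℤ_[3]) ^ 2} :=
      Ideal.mem_span_singleton.2 ⟨ξ, by norm_num⟩
    have := (PadicInt.norm_le_pow_iff_mem_span_pow (9 * ξ) 2).2 (by exact_mod_cast hmem)
    rw [e, ← PadicInt.norm_def]
    exact_mod_cast this
  obtain ⟨w, hw⟩ := ThreeTorsionNormalForm.exists_pow_three_eq_of_norm_sub_one_le h9
  rcases hε with rfl | rfl
  · exact ⟨w, by simpa using hw⟩
  · refine ⟨-w, ?_⟩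
    push_cast at hw
    linear_combination -hw

/-! ### Finite residue checks -/

/-- The affine points of `ȳ² + d̄ȳ = x̄³` over `𝔽₃` for a unit `d̄`: `(0, 0)`, `(0, −d̄)` and the cusp
`(−1, d̄)`. [folklore] -/
private theorem zmod3_points : ∀ x y d : ZMod 3, d ≠ 0 → y ^ 2 + d * y = x ^ 3 →
    (x = 0 ∧ y = 0) ∨ (x = 0 ∧ y + d = 0) ∨ (x + 1 = 0 ∧ y - d = 0) := by decide

/-- `t² = 0 → t = 0` in `𝔽₃`. [folklore] -/
private theorem zmod3_sq_eq_zero : ∀ t : ZMod 3, t ^ 2 = 0 → t = 0 := by decide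

/-- `t ≠ 0 → t² − 1 = 0` in `𝔽₃`. [folklore] -/
private theorem zmod3_sq_sub_one : ∀ t : ZMod 3, t ≠ 0 → t ^ 2 - 1 = 0 := by decide

end Residue

/-! ## §2 The three residue classes of integral points of `Y² + 3B·XY + D·Y = X³`, `D ≡ B³ (mod 27)` -/

section Integral

variable {B D X Y : ℤ_[3]}

/-- A unit `D` with `9 ∣ B³ − D` has `D ≡ ±1 (mod 9)` (cubes of units of `ℤ/9` are `±1`), and then
`B` is a unit too. [folklore] -/
private theorem sq_toZModPow_two_eq_one (hD : IsUnit D) (h9 : (9 : ℤ_[3]) ∣ B ^ 3 - D) :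
    (PadicInt.toZModPow 2 D) ^ 2 = 1 ∧ IsUnit B := by
  have h0 : PadicInt.toZModPow 2 (B ^ 3 - D) = 0 := (toZModPow_two_eq_zero_iff_dvd _).2 h9
  rw [map_sub, map_pow, sub_eq_zero] at h0
  have hDu : IsUnit (PadicInt.toZModPow 2 D) := hD.map _
  rw [← h0] at hDu
  have hBu : IsUnit (PadicInt.toZModPow 2 B) := (isUnit_pow_iff three_ne_zero).1 hDu
  obtain ⟨t, ht⟩ := hBu.exists_right_inv
  refine ⟨by rw [← h0]; exact ThreeTorsionNormalForm.zmod9_cube_sq_eq_one _ _ ht, ?_⟩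
  -- `B` is a unit of `ℤ₃`: its residue mod `3` is non-zero
  rw [PadicInt.isUnit_iff]
  refine norm_eq_one_of_toZMod_ne_zero fun hB0 => ?_
  obtain ⟨β, hβ⟩ := exists_eq_three_mul hB0
  have h3 : PadicInt.toZModPow 2 B ^ 2 = 0 := by
    rw [hβ, map_mul, mul_pow, map_ofNat]
    have : (3 : ZMod (3 ^ 2)) ^ 2 = 0 := by decide
    rw [this, zero_mul]
  have h1 : (PadicInt.toZModPow 2 B * t) ^ 2 = 1 := by rw [ht, one_pow]
  rw [mul_pow, h3, zero_mul] at h1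
  exact absurd h1 (by decide)

/-- **Over `(0, 0)`.** On `Y² + 3B·XY + DY = X³` in `ℤ₃` with `D` a unit, `9 ∣ B³ − D`: if
`X ≡ Y ≡ 0 (mod 3)` then `Y` is a cube in `ℚ₃` — `27 ∣ Y`, so `U := Y + 3BX + D ≡ D ≡ ±1 (mod 9)` is a
cube and `Y = (X/c)³` for `U = c³`. [folklore] -/
private theorem cube_of_residue_zero_zero (hD : IsUnit D) (h9 : (9 : ℤ_[3]) ∣ B ^ 3 - D)
    (hE : Y ^ 2 + 3 * B * X * Y + D * Y = X ^ 3)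
    (hx : PadicInt.toZMod X = 0) (hy : PadicInt.toZMod Y = 0) : ∃ w : ℚ_[3], (Y : ℚ_[3]) = w ^ 3 := by
  obtain ⟨hD9, -⟩ := sq_toZModPow_two_eq_one hD h9
  obtain ⟨ξ, hξ⟩ := exists_eq_three_mul hx
  set U : ℤ_[3] := Y + 3 * B * X + D with hU
  have hYU : Y * U = X ^ 3 := by rw [hU]; linear_combination hE
  have hU3 : PadicInt.toZMod U = PadicInt.toZMod D := by
    rw [hU]
    simp only [map_add, map_mul, hx, hy, mul_zero, zero_add]
  have hUn : ‖U‖ = 1 := norm_eq_one_of_toZMod_ne_zero (by rw [hU3]; exact toZMod_ne_zero_of_isUnit hD)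
  have hinv : U * U.inv = 1 := PadicInt.mul_inv hUn
  have hY : Y = 27 * (ξ ^ 3 * U.inv) := by
    calc Y = Y * (U * U.inv) := by rw [hinv, mul_one]
      _ = X ^ 3 * U.inv := by rw [← mul_assoc, hYU]
      _ = 27 * (ξ ^ 3 * U.inv) := by rw [hξ]; ring
  have h27 : (27 : ZMod (3 ^ 2)) = 0 := by decide
  have h9' : (9 : ZMod (3 ^ 2)) = 0 := by decide
  have hY9 : PadicInt.toZModPow 2 Y = 0 := by
    rw [hY, map_mul, map_ofNat, h27, zero_mul]
  have hU9 : PadicInt.toZModPow 2 U = PadicInt.toZModPow 2 D := by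
    have e : U = Y + 9 * (B * ξ) + D := by rw [hU, hξ]; ring
    rw [e, map_add, map_add, map_mul, map_ofNat, h9', zero_mul, add_zero, hY9, zero_add]
  obtain ⟨c, hc⟩ := exists_pow_three_eq_of_sq_eq_one (u := U) (by rw [hU9, hD9])
  have hc0 : c ≠ 0 := by
    rintro rfl
    have hU0 : U = 0 := PadicInt.coe_eq_zero.1 (by rw [hc]; ring)
    rw [hU0, norm_zero] at hUn
    exact zero_ne_one hUn
  refine ⟨(X : ℚ_[3]) / c, ?_⟩
  have hQ : (Y : ℚ_[3]) * c ^ 3 = (X : ℚ_[3]) ^ 3 := by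
    have h := congrArg Subtype.val hYU
    push_cast at h
    rw [← hc]; exact h
  field_simp
  linear_combination hQ

/-- **Over `(0, −d̄)`.** With `D` a unit and `9 ∣ B³ − D`: if `X ≡ 0`, `Y ≡ −D (mod 3)` then `Y` is a unit
with `27 ∣ U = Y + 3BX + D = X³/Y`, so `Y ≡ −D ≡ ∓1 (mod 9)` is a cube. [folklore] -/
private theorem cube_of_residue_zero_neg (hD : IsUnit D) (h9 : (9 : ℤ_[3]) ∣ B ^ 3 - D)
    (hE : Y ^ 2 + 3 * B * X * Y + D * Y = X ^ 3)
    (hx : PadicInt.toZMod X = 0) (hy : PadicInt.toZMod (Y + D) = 0) :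
    ∃ w : ℚ_[3], (Y : ℚ_[3]) = w ^ 3 := by
  obtain ⟨hD9, -⟩ := sq_toZModPow_two_eq_one hD h9
  obtain ⟨ξ, hξ⟩ := exists_eq_three_mul hx
  set U : ℤ_[3] := Y + 3 * B * X + D with hU
  have hYU : Y * U = X ^ 3 := by rw [hU]; linear_combination hE
  -- `Y` is a unit: `Y ≡ −D ≢ 0 (mod 3)`
  have hY3 : PadicInt.toZMod Y = -PadicInt.toZMod D := by
    rw [map_add] at hy; linear_combination hy
  have hYn : ‖Y‖ = 1 :=
    norm_eq_one_of_toZMod_ne_zero (by rw [hY3, neg_ne_zero]; exact toZMod_ne_zero_of_isUnit hD)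
  have hinv : Y * Y.inv = 1 := PadicInt.mul_inv hYn
  have hUeq : U = 27 * (ξ ^ 3 * Y.inv) := by
    calc U = U * (Y * Y.inv) := by rw [hinv, mul_one]
      _ = X ^ 3 * Y.inv := by rw [← mul_assoc, mul_comm U Y, hYU]
      _ = 27 * (ξ ^ 3 * Y.inv) := by rw [hξ]; ring
  have h27 : (27 : ZMod (3 ^ 2)) = 0 := by decide
  have h9' : (9 : ZMod (3 ^ 2)) = 0 := by decide
  have hU9 : PadicInt.toZModPow 2 U = 0 := by rw [hUeq, map_mul, map_ofNat, h27, zero_mul]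
  have hY9 : PadicInt.toZModPow 2 Y = -PadicInt.toZModPow 2 D := by
    have e : U = Y + 9 * (B * ξ) + D := by rw [hU, hξ]; ring
    rw [e, map_add, map_add, map_mul, map_ofNat, h9', zero_mul, add_zero] at hU9
    linear_combination hU9
  exact exists_pow_three_eq_of_sq_eq_one (u := Y) (by rw [hY9, neg_sq, hD9])

/-- **Over the cusp `(−1, d̄)`.** With `D` a unit and `27 ∣ B³ − D`: if `X ≡ −1`, `Y ≡ D (mod 3)` then
`Y ≡ D (mod 9)`, hence `Y` is a cube.  Writing `X = −1 + 3ξ`, `Y = D + 3η`, `D = B³ − 27κ`,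
`B² = 1 + 3μ`, the curve equation is the identity `9(η² + 3R) = S·(B² − 1 − 3μ)` for the explicit
polynomials `R, S` below, so `η² = −3R` and `3 ∣ η`. [folklore] -/
private theorem cube_of_residue_cusp (hD : IsUnit D) (h27 : (27 : ℤ_[3]) ∣ B ^ 3 - D)
    (hE : Y ^ 2 + 3 * B * X * Y + D * Y = X ^ 3)
    (hx : PadicInt.toZMod (X + 1) = 0) (hy : PadicInt.toZMod (Y - D) = 0) :
    ∃ w : ℚ_[3], (Y : ℚ_[3]) = w ^ 3 := by
  have h9 : (9 : ℤ_[3]) ∣ B ^ 3 - D := (show (9 : ℤ_[3]) ∣ 27 from ⟨3, by norm_num⟩).trans h27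
  obtain ⟨hD9, hB⟩ := sq_toZModPow_two_eq_one hD h9
  obtain ⟨κ, hκ⟩ := h27
  obtain ⟨ξ, hξ⟩ := exists_eq_three_mul hx
  obtain ⟨η, hη⟩ := exists_eq_three_mul hy
  -- `B² = 1 + 3μ`
  have hB3 : PadicInt.toZMod (B ^ 2 - 1) = 0 := by
    rw [map_sub, map_pow, map_one]
    exact zmod3_sq_sub_one _ (toZMod_ne_zero_of_isUnit hB)
  obtain ⟨μ, hμ⟩ := exists_eq_three_mul hB3
  have hX : X = -1 + 3 * ξ := by linear_combination hξ
  have hY : Y = D + 3 * η := by linear_combination hη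
  have hDB : D = B ^ 3 - 27 * κ := by linear_combination -hκ
  have hμ' : B ^ 2 = 1 + 3 * μ := by linear_combination hμ
  -- the cusp identity
  have key : (9 : ℤ_[3]) * (η ^ 2 + 3 * (μ ^ 2 + 2 * μ ^ 3 + 54 * κ ^ 2 - 9 * η * κ + 2 * ξ * μ
      + 3 * ξ * μ ^ 2 + ξ ^ 2 - ξ ^ 3 - B * κ - 12 * B * κ * μ + B * η * μ - 9 * B * ξ * κ
      + B * ξ * η)) = 0 := by
    rw [hX, hY, hDB] at hE
    linear_combination hE - (-1 + 3 * μ + 18 * μ ^ 2 + 9 * ξ + 27 * ξ * μ - 108 * B * κ + 9 * B * η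
      - B ^ 2 + 6 * B ^ 2 * μ + 9 * B ^ 2 * ξ + 2 * B ^ 4) * hμ'
  have hη2 : η ^ 2 = 3 * (-(μ ^ 2 + 2 * μ ^ 3 + 54 * κ ^ 2 - 9 * η * κ + 2 * ξ * μ
      + 3 * ξ * μ ^ 2 + ξ ^ 2 - ξ ^ 3 - B * κ - 12 * B * κ * μ + B * η * μ - 9 * B * ξ * κ
      + B * ξ * η)) := by
    have h9ne : (9 : ℤ_[3]) ≠ 0 := by norm_num
    linear_combination (mul_left_cancel₀ h9ne (key.trans (mul_zero (9 : ℤ_[3])).symm))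
  -- `3 ∣ η`
  have hη3 : PadicInt.toZMod η = 0 := by
    apply zmod3_sq_eq_zero
    rw [← map_pow, hη2, map_mul, map_ofNat]
    have : (3 : ZMod 3) = 0 := by decide
    rw [this, zero_mul]
  obtain ⟨η', hη'⟩ := exists_eq_three_mul hη3
  -- `Y ≡ D (mod 9)`
  have h9' : (9 : ZMod (3 ^ 2)) = 0 := by decide
  have hY9 : PadicInt.toZModPow 2 Y = PadicInt.toZModPow 2 D := by
    have e : Y = D + 9 * η' := by rw [hY, hη']; ring
    rw [e, map_add, map_mul, map_ofNat, h9', zero_mul, add_zero]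
  exact exists_pow_three_eq_of_sq_eq_one (u := Y) (by rw [hY9, hD9])

/-- **All integral points.** On `Y² + 3B·XY + DY = X³` in `ℤ₃` with `D` a unit and `27 ∣ B³ − D`, EVERY
solution has `Y` a cube in `ℚ₃`: the reduction mod `3` is `ȳ² + d̄ȳ = x̄³`, whose points are `(0,0)`,
`(0,−d̄)`, `(−1, d̄)` (`zmod3_points`), and each class is one of the three lemmas above. [folklore] -/
theorem exists_pow_three_eq_of_integral {B D X Y : ℤ_[3]} (hD : IsUnit D) (h27 : (27 : ℤ_[3]) ∣ B ^ 3 - D)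
    (hE : Y ^ 2 + 3 * B * X * Y + D * Y = X ^ 3) : ∃ w : ℚ_[3], (Y : ℚ_[3]) = w ^ 3 := by
  have h9 : (9 : ℤ_[3]) ∣ B ^ 3 - D := (show (9 : ℤ_[3]) ∣ 27 from ⟨3, by norm_num⟩).trans h27
  have hd0 : PadicInt.toZMod D ≠ 0 := toZMod_ne_zero_of_isUnit hD
  have hred : PadicInt.toZMod Y ^ 2 + PadicInt.toZMod D * PadicInt.toZMod Y = PadicInt.toZMod X ^ 3 := by
    have h := congrArg PadicInt.toZMod hE
    simp only [map_add, map_mul, map_pow, map_ofNat] at h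
    have h3 : (3 : ZMod 3) = 0 := by decide
    rw [h3] at h
    linear_combination h
  rcases zmod3_points _ _ _ hd0 hred with ⟨hx, hy⟩ | ⟨hx, hy⟩ | ⟨hx, hy⟩
  · exact cube_of_residue_zero_zero hD h9 hE hx hy
  · exact cube_of_residue_zero_neg hD h9 hE hx (by rw [map_add]; exact hy)
  · exact cube_of_residue_cusp hD h27 hE (by rw [map_add, map_one]; exact hx)
      (by rw [map_sub]; exact hy)

end Integral

end Summit.BirchSwinnertonDyer.Rank1Residual.O5.FlexTangent

end
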